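import Summits.BirchSwinnertonDyer.BirchSwinnertonDyer.Theorems.PrintCFramBottomClassIndexLawFiveLeBorelGrossSurjectivityLeaf
import Summits.BirchSwinnertonDyer.Rank1Residual.X2.ResidualDevissageModules
import HarnessLib

/-!
# Route `PrintCFram`, crux C2 `BottomClassIndexLawFiveLe` (stmt-BirchSwinnertonDyer-20372), line
# `eisenstein-resource-bdp-line` (Stub H `stub_bottomResidualSelmer_trivial_of_bernoulliPair` and
# every statement quantifying over «a `Γ_{K''}`-stable line `Φ ≤ W_{K''}[p]` of order `p`»):
# **there is exactly ONE such line — the transported `W[𝔭] = ker √−p`** — over every number field of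
# degree `< p`
# (cell `bsd-print-cfram`, seat `bsd-line-cfram-p1-w2` g5; helper `--supports` 20372; 0 facts, 0 defs)

HONEST FRAMING. Nothing about BSD is proved here, and nothing of Stub H itself. Registry v10's Stub H
concludes, for EVERY `Γ_{K''}`-stable `Φ : StableSubgroup Γ_{K''} W(K̄'')[p]` of order `p`, the
triviality of two residual Selmer groups. By the uniseriality of `W[p]` at the Borel CM-ramified prime
(`uniserial_geomTorsion_baseChange_of_cmRamified`, file 8c: every `Γ_{K''}`-stable subgroup of
`W(K̄'')[p]` is `⊥`, `L` or `⊤`, `L = θ(ker μ ∩ W[p])`) the quantifier ranges over a SINGLE line: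
* `stableSubgroup_mem_iff_of_card` — `W/ℚ` CM, `p ≥ 5` CM-ramified, `μ = √−p` with its sign rule,
  `[K'' : ℚ] < p` (Heegner fields, `ℚ(√−p)`, `K·K''`): a `Γ_{K''}`-stable subgroup of `W(K̄'')[p]`
  of order `p` is `{t : μ(θ⁻¹ t) = 0}`, the rational line `W[𝔭]`;
* `stableSubgroup_eq_of_card` — any two such `Φ, Ψ` have the same underlying subgroup.
So in Stub H (and in the v10 composition) `Φ = W[𝔭]_{K''}` without loss, `Φ.Sub ≅ 𝔽_p(ψ)`-side and
`Φ.Quot` the other character of the trace form; no case analysis over lines is needed.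
THEOREMS ONLY; no definition, no named fact, no `sorry`. BSD is not proved by any of this; no summit
statement is proved by this seat.
References: [Rubin1999] Cor. 5.5; [GreenbergVatsal2000] §2 p. 28 (`Φ`).
-/

set_option autoImplicit false
-- `…BirchSwinnertonDyer.BirchSwinnertonDyer.Theorems…` is the problem's mandated namespace (D-0017).
set_option linter.dupNamespace false

noncomputable section

open scoped Classical

namespace Summit.BirchSwinnertonDyer.BirchSwinnertonDyer.Theorems.PrintCFram.BorelKolyvaginPairing

open WeierstrassCurve Field Literature.NumberTheory.EllipticCurves
  Literature.NumberTheory.GaloisRepresentations Literature.NumberTheory.EllipticCurves.Rank1Residual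
  Summit.BirchSwinnertonDyer.BirchSwinnertonDyer.Theorems.PrintCFram.BorelHomothety
  Summit.BirchSwinnertonDyer.Rank1Residual.X2.ResidualDevissageModules

section UniqueLine

variable (W : WeierstrassCurve ℚ) [W.IsElliptic] (p : ℕ) [hp : Fact p.Prime]
variable (K : Type) [Field K] [NumberField K]

/-- **The unique `Γ_{K''}`-stable line of `W(K̄'')[p]` is `W[𝔭]`.** For `W/ℚ` with CM, `p ≥ 5`
CM-ramified, `μ = √−p` with its sign rule (`exists_sqrt_end_of_cmRamified`), `[K'' : ℚ] < p`, and a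
`Γ_{K''}`-stable subgroup `Φ` of `W(K̄'')[p]` of order `p`: `t ∈ Φ ⟺ μ(θ⁻¹ t) = 0`
(`θ = RatClosure.torsionEquiv`). Uniseriality (file 8c) leaves `⊥` (order `1`), `L` (order `p`) or
`⊤` (order `p²`). [cite: Rubin1999, Cor. 5.5] [cite: GreenbergVatsal2000, §2 p. 28] -/
theorem stableSubgroup_mem_iff_of_card (hCM : W.HasCM) (h5 : 5 ≤ p) (hram : CMRamified W p)
    {s : AlgebraicClosure ℚ} {μ : AddMonoid.End W.geomPoints} {m : ℤ}
    (hs : s ^ 2 = ((-(p : ℤ) : ℤ) : AlgebraicClosure ℚ)) (hm : m.natAbs = p)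
    (hμμ : ∀ P, μ (μ P) = m • P)
    (hcomm : ∀ g : absoluteGaloisGroup ℚ, g • s = s → ∀ P, μ (g • P) = g • μ P)
    (hanti : ∀ g : absoluteGaloisGroup ℚ, g • s = -s → ∀ P, μ (g • P) = -(g • μ P))
    (hK : Module.finrank ℚ K < p)
    (Φ : StableSubgroup (absoluteGaloisGroup K) (geomTorsion (W.baseChange K) (p : ℤ)))
    (hΦ : Nat.card Φ.Sub = p) :
    ∀ t, t ∈ Φ.toAddSubgroup ↔
      μ ((RatClosure.torsionEquiv (K := K) W (p : ℤ)).symm t : W.geomTorsion (p : ℤ)) = 0 := by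
  have hpr : p.Prime := hp.out
  have hcardΦ : Nat.card Φ.toAddSubgroup = p := hΦ
  obtain ⟨L, -, hmemL, -, -, hS⟩ :=
    uniserial_geomTorsion_baseChange_of_cmRamified W p K hCM h5 hram hs hm hμμ hcomm hanti hK
  rcases hS Φ.toAddSubgroup (fun g t ht => Φ.smul_mem' g ht) with h | h | h
  · exfalso
    rw [h, AddSubgroup.card_bot] at hcardΦ
    exact hpr.one_lt.ne hcardΦ
  · intro t; rw [h]; exact hmemL t
  · exfalso
    have hsq : Nat.card (geomTorsion (W.baseChange K) (p : ℤ)) = p ^ 2 := by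
      rw [← Nat.card_congr (RatClosure.torsionEquiv (K := K) W (p : ℤ)).toEquiv]
      exact W.natCard_geomTorsion_prime_eq_sq hpr
    rw [h, AddSubgroup.card_top, hsq] at hcardΦ
    have : p * p = p * 1 := by rw [mul_one, ← sq]; exact hcardΦ
    exact hpr.one_lt.ne' (Nat.eq_of_mul_eq_mul_left hpr.pos this)

/-- **Uniqueness**: two `Γ_{K''}`-stable subgroups of `W(K̄'')[p]` of order `p` coincide
(`[K'' : ℚ] < p`, Borel CM-ramified class). [cite: Rubin1999, Cor. 5.5] -/
theorem stableSubgroup_eq_of_card (hCM : W.HasCM) (h5 : 5 ≤ p) (hram : CMRamified W p)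
    (hK : Module.finrank ℚ K < p)
    (Φ Ψ : StableSubgroup (absoluteGaloisGroup K) (geomTorsion (W.baseChange K) (p : ℤ)))
    (hΦ : Nat.card Φ.Sub = p) (hΨ : Nat.card Ψ.Sub = p) :
    Φ.toAddSubgroup = Ψ.toAddSubgroup := by
  obtain ⟨s, μ, m, hs, hm, hμμ, hcomm, hanti⟩ := exists_sqrt_end_of_cmRamified W p hCM h5 hram
  ext t
  rw [stableSubgroup_mem_iff_of_card W p K hCM h5 hram hs hm hμμ hcomm hanti hK Φ hΦ t,
    stableSubgroup_mem_iff_of_card W p K hCM h5 hram hs hm hμμ hcomm hanti hK Ψ hΨ t]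

/-- **Existence**: the line `W[𝔭]` IS a `Γ_{K''}`-stable subgroup of order `p` — so the family
quantified over in Stub H is non-empty and the quantifier is exactly «`Φ = W[𝔭]`». Stated without
constructing a `StableSubgroup`: there is a `Γ_{K''}`-stable `AddSubgroup` of order `p`, namely
`{t : μ(θ⁻¹ t) = 0}`. [cite: Rubin1999, Cor. 5.5] -/
theorem exists_stable_line_card_eq (hCM : W.HasCM) (h5 : 5 ≤ p) (hram : CMRamified W p)
    {s : AlgebraicClosure ℚ} {μ : AddMonoid.End W.geomPoints} {m : ℤ}
    (hs : s ^ 2 = ((-(p : ℤ) : ℤ) : AlgebraicClosure ℚ)) (hm : m.natAbs = p)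
    (hμμ : ∀ P, μ (μ P) = m • P)
    (hcomm : ∀ g : absoluteGaloisGroup ℚ, g • s = s → ∀ P, μ (g • P) = g • μ P)
    (hanti : ∀ g : absoluteGaloisGroup ℚ, g • s = -s → ∀ P, μ (g • P) = -(g • μ P))
    (hK : Module.finrank ℚ K < p) :
    ∃ L : AddSubgroup (geomTorsion (W.baseChange K) (p : ℤ)),
      (∀ g : absoluteGaloisGroup K, ∀ t ∈ L, g • t ∈ L) ∧ Nat.card L = p ∧
      ∀ t, t ∈ L ↔ μ ((RatClosure.torsionEquiv (K := K) W (p : ℤ)).symm t : W.geomTorsion (p : ℤ)) = 0 := by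
  have hpr : p.Prime := hp.out
  obtain ⟨L, -, hmemL, hL, -, -⟩ :=
    uniserial_geomTorsion_baseChange_of_cmRamified W p K hCM h5 hram hs hm hμμ hcomm hanti hK
  refine ⟨L, hL, ?_, hmemL⟩
  -- `L ≃ ker μ` along `θ⁻¹` and the inclusion, `# ker μ = p`
  set θ := RatClosure.torsionEquiv (K := K) W (p : ℤ) with hθ
  have hk := natCard_ker_eq (μ : W.geomPoints →+ W.geomPoints) hμμ hm hpr
    (W.natCard_geomTorsion_prime_eq_sq hpr) (exists_mem_geomTorsion_apply_ne_zero W p hμμ hm)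
  have hkerle : (μ : W.geomPoints →+ W.geomPoints).ker ≤ W.geomTorsion (p : ℤ) :=
    ker_le_torsionBy (μ : W.geomPoints →+ W.geomPoints) hμμ hm
  have hto : ∀ t : L, ((θ.symm (t : geomTorsion (W.baseChange K) (p : ℤ)) : W.geomTorsion (p : ℤ)) :
      W.geomPoints) ∈ (μ : W.geomPoints →+ W.geomPoints).ker := fun t => by
    rw [AddMonoidHom.mem_ker]; exact (hmemL _).mp t.2
  have hinv : ∀ P : (μ : W.geomPoints →+ W.geomPoints).ker,
      θ ⟨(P : W.geomPoints), hkerle P.2⟩ ∈ L := fun P => by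
    rw [hmemL, θ.symm_apply_apply]
    exact (AddMonoidHom.mem_ker).mp P.2
  let ε : L ≃ (μ : W.geomPoints →+ W.geomPoints).ker :=
    { toFun := fun t => ⟨_, hto t⟩
      invFun := fun P => ⟨_, hinv P⟩
      left_inv := fun t => Subtype.ext (by simp)
      right_inv := fun P => Subtype.ext (by simp) }
  exact (Nat.card_congr ε).trans hk

end UniqueLine

end Summit.BirchSwinnertonDyer.BirchSwinnertonDyer.Theorems.PrintCFram.BorelKolyvaginPairing

end
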